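import Summits.RiemannHypothesis.RiemannHypothesis.Theorems.TiltedLandingLaw421R3TouchedDissipation
import Summits.RiemannHypothesis.RiemannHypothesis.Theorems.TiltedLandingLaw421R3PairSign

/-! # Canopy-v2 — the CANOPY LEMMA, statement first ((CA749)(A)(ii) support candidate; lens-2 g9 O10-c(i); TWO TREE imports; registry-neutral)
K-level half (PROVED): the tree's sign kernel `pairPull_nonpos_iff` says an UNCOVERING pair pulls down; the canopy needs HOW MUCH — under the touch /
disc-neighbour relation `|Re z − Re u| ≤ Im z + Im u` a lower-or-level neighbour pair `{u, ū}` pulls `z` down at rate `≥ 1/(2(Im z + Im u))`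
(`pairPull_le_of_touch_lower`), and finitely many such neighbours add up (`canopy_sum_le`).  LAW-level half (OPEN, statement only): `CanopyDescentSig κ` —
a toucher of the lowest state that no other upper zero COVERS has a Jensen-nested child IN THE CLOSED UPPER HALF-PLANE lower by `κ·s²/(Im z + Im v)` (v2 = v1 + the pin
`0 ≤ z'.im`, desk g31 l.8657 (b): without it the mirror child `conj z'` meets any descent for free; `κ` is left free BY DESIGN — the candidate is an instance with `0 < κ`,
at `κ ≤ 0` it degenerates to pinned nested-child existence, not vacuous); why it might fail: the far field and the tilt can cancel an O(1/h) pull at `|K| ≈ η/s` only up to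
the column budget — if not, an allowance must enter.  Nothing here bears on RH; RH is not proved. -/

namespace RhW08.Canopy

open RhW08.UncoveredSign (pairPull)
open RhW08.PairSign (pairPull_eq)
open RhW08.Round1 RhW08.QuadW RhW08.TouchedDissipation RhIdea6.G17.W07C7 RhIdea6.G17.W07C7.Rev6 RhIdea6.G18.W07C8.Law421BirthS
open RhIdea6.G19.W07C11.Seam RhIdea6.G20.W07C12.StColP RhW07.C12.FieldSplit

/-- (K) CANOPY PULL: `0 < Im u ≤ Im z`, `|Re z − Re u| ≤ Im z + Im u` ⇒ `pairPull z u ≤ −1/(2·(Im z + Im u))` (quantified `pairPull_upper_neg`). -/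
theorem pairPull_le_of_touch_lower {z u : ℂ} (hu : 0 < u.im) (huz : u.im ≤ z.im) (ht : |z.re - u.re| ≤ z.im + u.im) :
    pairPull z u ≤ -1 / (2 * (z.im + u.im)) := by
  rw [pairPull_eq z u]
  have hab : 0 < z.im + u.im := by linarith
  have hsq : (z.re - u.re) ^ 2 ≤ (z.im + u.im) ^ 2 := by nlinarith [abs_nonneg (z.re - u.re), sq_abs (z.re - u.re)]
  have hN2 : 0 < (z.re - u.re) ^ 2 + (z.im + u.im) ^ 2 := by positivity
  have h1 : (u.im - z.im) / ((z.re - u.re) ^ 2 + (z.im - u.im) ^ 2) ≤ 0 := div_nonpos_of_nonpos_of_nonneg (by linarith) (by positivity)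
  have h2 : 1 / (2 * (z.im + u.im)) ≤ (u.im + z.im) / ((z.re - u.re) ^ 2 + (z.im + u.im) ^ 2) := by
    rw [div_le_div_iff₀ (by positivity) hN2]; nlinarith
  rw [neg_div]; linarith

/-- (K) a finite canopy of lower-or-level touch-neighbours pulls down by at least the sum of the rates. -/
theorem canopy_sum_le {z : ℂ} (U : Finset ℂ) (hU : ∀ u ∈ U, 0 < u.im ∧ u.im ≤ z.im ∧ |z.re - u.re| ≤ z.im + u.im) :
    ∑ u ∈ U, pairPull z u ≤ -∑ u ∈ U, 1 / (2 * (z.im + u.im)) := by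
  rw [← Finset.sum_neg_distrib]
  exact Finset.sum_le_sum fun u hu => by rw [← neg_div]; exact pairPull_le_of_touch_lower (hU u hu).1 (hU u hu).2.1 (hU u hu).2.2

/-- SUPPORT CANDIDATE (OPEN) **CANOPY DESCENT** (pinned form): an uncovered toucher `z` of the lowest state `v` has an upper Jensen-nested child lower by `κ·s²/(Im z + Im v)`. -/
def CanopyDescentSig (κ : ℝ) : Prop :=
  ∀ (η : ℝ) (f : ℂ → ℂ) (x₀ s hmax R Hs : ℝ) (B : ℕ), EngineHyps5 2 η f x₀ s hmax R Hs B → ∀ (j : ℕ) (v z : ℂ),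
    IsLowest StTrkDQ η f x₀ s hmax R Hs B j v → Touches f j v z →
    (∀ u : ℂ, iteratedDeriv j f u = 0 → 0 < u.im → u ≠ z → u.im ^ 2 ≤ z.im ^ 2 + (z.re - u.re) ^ 2) →
    ∃ z' : ℂ, iteratedDeriv (j + 1) f z' = 0 ∧ 0 ≤ z'.im ∧ NestedStep z z' ∧ z'.im + κ * s ^ 2 / (z.im + v.im) ≤ z.im

end RhW08.Canopy
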